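/-
Copyright: the b2b-balaban T⁴-continuum CRUX team, row NE7b OWNER lineage `t4-ne7b-p1` (gen 141). Project licence.
-/
import Summits.QuantumFields.BalabanUV.T4Continuum.Spine.NE7b.SupFourthCumulantPairCutsTwo
import Summits.QuantumFields.BalabanUV.T4Continuum.Spine.NE7b.SupFourthCumulantSingleCuts
import Summits.QuantumFields.BalabanUV.T4Continuum.Spine.NE7b.SupFourthCumulantSingleCutsTwo

/-!
# THE FOURTH CUMULANT HAS TREE DECAY (SCOPING (d13)(2), ninth file): (492)'s three pair cuts and (493)'s four single cuts are exactly the seven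
# hypotheses of (487) `four_point_cut_tree`, whence
#   `|u₄| ≤ (4K + 3K² + 4M₄ + 4M₆ + 2M₂(M₂+M₄))·Σ_T Π_{e∈T} r_e⁻²`   over the sixteen labelled spanning trees of the four observables
# — TREE DECAY OF THE FOURTH CUMULANT under Dobrushin's condition, at the twelfth root of the two-point rate, every constant explicit; with (488)
# the three-index row sums are `≤ 16·C·S³` (`Σ_vr_{uv}⁻² ≤ S`).  This is the order-4 analogue of (468)'s order-3 letter, in the abstract Gibbs
# format (row NE7b, node U5c; (487), (492), (493) BY NAME; [folklore])

Cell `pub-balaban`, sub-cell `t4`, spine estimate NE7b (`T4WeightBudget.RelWeightBound`; the cell's OWN estimate — NOT PRINTED in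
[Bałaban 1983–89], NOT PROVED).  Crux-route work under `Spine/NE7b/` by the row OWNER (`t4-ne7b-p1` gen 141, file (496)) under FREEZE
(0)'s crux-prover clause; NOTHING of Bałaban's is named as a Lean object, valued or asserted; no `T4Continuum/Support` leaf typed; no
`def`, no notation (`u₄` WRITTEN OUT); zero `sorry`.  Imports (BY NAME): the OWNER's (492)–(495) (the seven cuts; through them (491), (487)).

WHAT IS PROVED ([folklore]): THE END **`fourth_cumulant_tree_bound`**.

HONEST (what this is NOT).  The abstract Gibbs-format statement; the whitened instantiation (`F_v = U′(Aξ+ψ)[e_v]`, `B ≤ K∕r²⁴` from (466) with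
`r²⁴ ≤ σσ`, `M₂, M₄` from (464)∕(465)), the sixth-moment letter `M₆` (NOT discharged — (423)'s Gaussian moments to `|φ|¹²` needed), the site-indexed
row letter via (488), and the cumulant FORM of `∂⁴W` with its assembly are the successor's; scalar skeleton ((A3), NC-NE7b-α UNRULED); nothing
of Bałaban's asserted.  BY-NAME EFFECT ON THE WALL: NONE.  NE7b NOT PRINTED ∕ NOT PROVED; spine PROVED 0∕9; rung (B)+1 — the programme's
measures remain FINITE-torus statements; NOT the mass gap, NOT Clay.  HONEST DEPENDENCY: continuum YM on T⁴ ⇐ BetaPertH ∧ nine spine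
estimates (0∕9 proved); BetaPertH ⇐ (D1) ∧ (D4) ∧ CAP+tail; G-an2-4 gates asym, D1 and NE2∕3∕4.
-/

set_option autoImplicit false

noncomputable section

namespace Summit.QuantumFields.BalabanUV.T4Continuum.NE7b.SupFourthCumulantTree

open MeasureTheory Real Set Function Finset
open scoped BigOperators
open SupFourPointCutTree (four_point_cut_tree)
open SupFourthCumulantPairCuts (cut_one_two)
open SupFourthCumulantPairCutsTwo (cut_one_three cut_one_four)
open SupFourthCumulantSingleCuts (cut_one cut_two)
open SupFourthCumulantSingleCutsTwo (cut_three cut_four)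

variable {ι : Type} [Fintype ι] [DecidableEq ι]

variable {V : (ι → ℝ) → ℝ} {V₁ : ι → (ι → ℝ) → ℝ} {c : ι → ℝ} {Cw γ : ℝ} {J D : ι → ι → ℝ}
  {P : ι → ((ι → ℝ) → ℝ) → ((ι → ℝ) → ℝ)} {F₁ F₂ F₃ F₄ : (ι → ℝ) → ℝ} {a₁ a₂ a₃ a₄ : ι → ℝ}

/-- **THE END — TREE DECAY OF THE FOURTH CUMULANT** (abstract Gibbs format; `M₆` a letter). [folklore] -/
theorem fourth_cumulant_tree_bound (hP : ∀ x F ω, P x F ω = (∫ s, F (update ω x s) * exp (-V (update ω x s))) / ∫ s, exp (-V (update ω x s)))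
    (hV : ∀ x ω, HasDerivAt (fun s => V (update ω x s)) (V₁ x ω) (ω x))
    (hfloor : ∀ x ω s t, c x * (s - t) ^ 2 ≤ (V₁ x (update ω x s) - V₁ x (update ω x t)) * (s - t)) (hc : ∀ x, 0 < c x)
    (hceil : ∀ x ω s t, |V₁ x (update ω x s) - V₁ x (update ω x t)| ≤ Cw * |s - t|)
    (hcross : ∀ x z, z ≠ x → ∀ ω s t, |V₁ x (update ω z s) - V₁ x (update ω z t)| ≤ J x z * |s - t|) (hVc : Continuous V)
    (hV0 : Integrable (fun ω : ι → ℝ => exp (-V ω))) (hV2 : ∀ z, Integrable (fun ω : ι → ℝ => ω z ^ 2 * exp (-V ω)))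
    (hJ : ∀ x z, 0 ≤ J x z) (hJ0 : ∀ x, J x x = 0) (hrow : ∀ x, ∑ z, J x z / c x ≤ γ) (hγ0 : 0 ≤ γ) (hγ1 : γ < 1)
    (hD : ∀ x y, 0 ≤ D x y) (hDC : ∀ x y, (if x = y then (1 : ℝ) else 0) + ∑ z, D x z * (J z y / c z) ≤ D x y)
    (h1 : ∀ z ω s t, |F₁ (update ω z s) - F₁ (update ω z t)| ≤ a₁ z * |s - t|) (h2 : ∀ z ω s t, |F₂ (update ω z s) - F₂ (update ω z t)| ≤ a₂ z * |s -
        t|)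
    (h3 : ∀ z ω s t, |F₃ (update ω z s) - F₃ (update ω z t)| ≤ a₃ z * |s - t|) (h4 : ∀ z ω s t, |F₄ (update ω z s) - F₄ (update ω z t)| ≤ a₄ z * |s -
        t|)
    {K r12 r13 r14 r23 r24 r34 M₂ M₄ M₆ : ℝ} (hK : 0 ≤ K) (hr12 : 1 ≤ r12) (hr13 : 1 ≤ r13) (hr14 : 1 ≤ r14) (hr23 : 1 ≤ r23) (hr24 : 1 ≤ r24) (hr34
        : 1 ≤ r34)
    (hB12 : (∑ w, (∑ z, D z w * a₁ z) * (∑ z, D z w * a₂ z) / c w) ≤ K / r12 ^ 24)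
    (hB13 : (∑ w, (∑ z, D z w * a₁ z) * (∑ z, D z w * a₃ z) / c w) ≤ K / r13 ^ 24)
    (hB14 : (∑ w, (∑ z, D z w * a₁ z) * (∑ z, D z w * a₄ z) / c w) ≤ K / r14 ^ 24)
    (hB23 : (∑ w, (∑ z, D z w * a₂ z) * (∑ z, D z w * a₃ z) / c w) ≤ K / r23 ^ 24)
    (hB24 : (∑ w, (∑ z, D z w * a₂ z) * (∑ z, D z w * a₄ z) / c w) ≤ K / r24 ^ 24)
    (hB34 : (∑ w, (∑ z, D z w * a₃ z) * (∑ z, D z w * a₄ z) / c w) ≤ K / r34 ^ 24)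
    (hq1 : Integrable (fun ω => (F₁ ω - (∫ ω', F₁ ω' ∂((volume : Measure (ι → ℝ)).tilted fun ω => -V ω))) ^ 4) ((volume : Measure (ι → ℝ)).tilted fun
        ω => -V ω)) (hs1 : Integrable (fun ω => (F₁ ω - (∫ ω', F₁ ω' ∂((volume : Measure (ι → ℝ)).tilted fun ω => -V ω))) ^ 6) ((volume : Measure (ι
        → ℝ)).tilted fun ω => -V ω))
    (hM21 : ∫ ω, (F₁ ω - (∫ ω', F₁ ω' ∂((volume : Measure (ι → ℝ)).tilted fun ω => -V ω))) ^ 2 ∂((volume : Measure (ι → ℝ)).tilted fun ω => -V ω) ≤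
        M₂) (hM41 : ∫ ω, (F₁ ω - (∫ ω', F₁ ω' ∂((volume : Measure (ι → ℝ)).tilted fun ω => -V ω))) ^ 4 ∂((volume : Measure (ι → ℝ)).tilted fun ω =>
        -V ω) ≤ M₄)
    (hM61 : ∫ ω, (F₁ ω - (∫ ω', F₁ ω' ∂((volume : Measure (ι → ℝ)).tilted fun ω => -V ω))) ^ 6 ∂((volume : Measure (ι → ℝ)).tilted fun ω => -V ω) ≤
        M₆)
    (hq2 : Integrable (fun ω => (F₂ ω - (∫ ω', F₂ ω' ∂((volume : Measure (ι → ℝ)).tilted fun ω => -V ω))) ^ 4) ((volume : Measure (ι → ℝ)).tilted fun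
        ω => -V ω)) (hs2 : Integrable (fun ω => (F₂ ω - (∫ ω', F₂ ω' ∂((volume : Measure (ι → ℝ)).tilted fun ω => -V ω))) ^ 6) ((volume : Measure (ι
        → ℝ)).tilted fun ω => -V ω))
    (hM22 : ∫ ω, (F₂ ω - (∫ ω', F₂ ω' ∂((volume : Measure (ι → ℝ)).tilted fun ω => -V ω))) ^ 2 ∂((volume : Measure (ι → ℝ)).tilted fun ω => -V ω) ≤
        M₂) (hM42 : ∫ ω, (F₂ ω - (∫ ω', F₂ ω' ∂((volume : Measure (ι → ℝ)).tilted fun ω => -V ω))) ^ 4 ∂((volume : Measure (ι → ℝ)).tilted fun ω =>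
        -V ω) ≤ M₄)
    (hM62 : ∫ ω, (F₂ ω - (∫ ω', F₂ ω' ∂((volume : Measure (ι → ℝ)).tilted fun ω => -V ω))) ^ 6 ∂((volume : Measure (ι → ℝ)).tilted fun ω => -V ω) ≤
        M₆)
    (hq3 : Integrable (fun ω => (F₃ ω - (∫ ω', F₃ ω' ∂((volume : Measure (ι → ℝ)).tilted fun ω => -V ω))) ^ 4) ((volume : Measure (ι → ℝ)).tilted fun
        ω => -V ω)) (hs3 : Integrable (fun ω => (F₃ ω - (∫ ω', F₃ ω' ∂((volume : Measure (ι → ℝ)).tilted fun ω => -V ω))) ^ 6) ((volume : Measure (ι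
        → ℝ)).tilted fun ω => -V ω))
    (hM23 : ∫ ω, (F₃ ω - (∫ ω', F₃ ω' ∂((volume : Measure (ι → ℝ)).tilted fun ω => -V ω))) ^ 2 ∂((volume : Measure (ι → ℝ)).tilted fun ω => -V ω) ≤
        M₂) (hM43 : ∫ ω, (F₃ ω - (∫ ω', F₃ ω' ∂((volume : Measure (ι → ℝ)).tilted fun ω => -V ω))) ^ 4 ∂((volume : Measure (ι → ℝ)).tilted fun ω =>
        -V ω) ≤ M₄)
    (hM63 : ∫ ω, (F₃ ω - (∫ ω', F₃ ω' ∂((volume : Measure (ι → ℝ)).tilted fun ω => -V ω))) ^ 6 ∂((volume : Measure (ι → ℝ)).tilted fun ω => -V ω) ≤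
        M₆)
    (hq4 : Integrable (fun ω => (F₄ ω - (∫ ω', F₄ ω' ∂((volume : Measure (ι → ℝ)).tilted fun ω => -V ω))) ^ 4) ((volume : Measure (ι → ℝ)).tilted fun
        ω => -V ω)) (hs4 : Integrable (fun ω => (F₄ ω - (∫ ω', F₄ ω' ∂((volume : Measure (ι → ℝ)).tilted fun ω => -V ω))) ^ 6) ((volume : Measure (ι
        → ℝ)).tilted fun ω => -V ω))
    (hM24 : ∫ ω, (F₄ ω - (∫ ω', F₄ ω' ∂((volume : Measure (ι → ℝ)).tilted fun ω => -V ω))) ^ 2 ∂((volume : Measure (ι → ℝ)).tilted fun ω => -V ω) ≤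
        M₂) (hM44 : ∫ ω, (F₄ ω - (∫ ω', F₄ ω' ∂((volume : Measure (ι → ℝ)).tilted fun ω => -V ω))) ^ 4 ∂((volume : Measure (ι → ℝ)).tilted fun ω =>
        -V ω) ≤ M₄)
    (hM64 : ∫ ω, (F₄ ω - (∫ ω', F₄ ω' ∂((volume : Measure (ι → ℝ)).tilted fun ω => -V ω))) ^ 6 ∂((volume : Measure (ι → ℝ)).tilted fun ω => -V ω) ≤
        M₆) :
    |(∫ ω, (F₁ ω - (∫ ω', F₁ ω' ∂((volume : Measure (ι → ℝ)).tilted fun ω => -V ω))) * (F₂ ω - (∫ ω', F₂ ω' ∂((volume : Measure (ι → ℝ)).tilted fun ω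
        => -V ω))) * (F₃ ω - (∫ ω', F₃ ω' ∂((volume : Measure (ι → ℝ)).tilted fun ω => -V ω))) * (F₄ ω - (∫ ω', F₄ ω' ∂((volume : Measure (ι →
        ℝ)).tilted fun ω => -V ω))) ∂((volume : Measure (ι → ℝ)).tilted fun ω => -V ω)) - (∫ ω, (F₁ ω - (∫ ω', F₁ ω' ∂((volume : Measure (ι →
        ℝ)).tilted fun ω => -V ω))) * (F₂ ω - (∫ ω', F₂ ω' ∂((volume : Measure (ι → ℝ)).tilted fun ω => -V ω))) ∂((volume : Measure (ι → ℝ)).tilted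
        fun ω => -V ω)) * (∫ ω, (F₃ ω - (∫ ω', F₃ ω' ∂((volume : Measure (ι → ℝ)).tilted fun ω => -V ω))) * (F₄ ω - (∫ ω', F₄ ω' ∂((volume : Measure
        (ι → ℝ)).tilted fun ω => -V ω))) ∂((volume : Measure (ι → ℝ)).tilted fun ω => -V ω)) - (∫ ω, (F₁ ω - (∫ ω', F₁ ω' ∂((volume : Measure (ι →
        ℝ)).tilted fun ω => -V ω))) * (F₃ ω - (∫ ω', F₃ ω' ∂((volume : Measure (ι → ℝ)).tilted fun ω => -V ω))) ∂((volume : Measure (ι → ℝ)).tilted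
        fun ω => -V ω)) * (∫ ω, (F₂ ω - (∫ ω', F₂ ω' ∂((volume : Measure (ι → ℝ)).tilted fun ω => -V ω))) * (F₄ ω - (∫ ω', F₄ ω' ∂((volume : Measure
        (ι → ℝ)).tilted fun ω => -V ω))) ∂((volume : Measure (ι → ℝ)).tilted fun ω => -V ω)) - (∫ ω, (F₁ ω - (∫ ω', F₁ ω' ∂((volume : Measure (ι →
        ℝ)).tilted fun ω => -V ω))) * (F₄ ω - (∫ ω', F₄ ω' ∂((volume : Measure (ι → ℝ)).tilted fun ω => -V ω))) ∂((volume : Measure (ι → ℝ)).tilted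
        fun ω => -V ω)) * (∫ ω, (F₂ ω - (∫ ω', F₂ ω' ∂((volume : Measure (ι → ℝ)).tilted fun ω => -V ω))) * (F₃ ω - (∫ ω', F₃ ω' ∂((volume : Measure
        (ι → ℝ)).tilted fun ω => -V ω))) ∂((volume : Measure (ι → ℝ)).tilted fun ω => -V ω))| ≤
      (4 * K + 3 * K ^ 2 + 4 * M₄ + 4 * M₆ + 2 * M₂ * (M₂ + M₄)) *
        ((r12 ^ 2)⁻¹ * (r13 ^ 2)⁻¹ * (r14 ^ 2)⁻¹ + (r12 ^ 2)⁻¹ * (r23 ^ 2)⁻¹ * (r24 ^ 2)⁻¹ + (r13 ^ 2)⁻¹ * (r23 ^ 2)⁻¹ * (r34 ^ 2)⁻¹ + (r14 ^ 2)⁻¹ *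
            (r24 ^ 2)⁻¹ * (r34 ^ 2)⁻¹ + (r12 ^ 2)⁻¹ * (r23 ^ 2)⁻¹ * (r34 ^ 2)⁻¹ + (r12 ^ 2)⁻¹ * (r24 ^ 2)⁻¹ * (r34 ^ 2)⁻¹ + (r13 ^ 2)⁻¹ * (r23 ^ 2)⁻¹
            * (r24 ^ 2)⁻¹ + (r13 ^ 2)⁻¹ * (r24 ^ 2)⁻¹ * (r34 ^ 2)⁻¹ + (r14 ^ 2)⁻¹ * (r23 ^ 2)⁻¹ * (r24 ^ 2)⁻¹ + (r14 ^ 2)⁻¹ * (r23 ^ 2)⁻¹ * (r34 ^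
            2)⁻¹ + (r12 ^ 2)⁻¹ * (r13 ^ 2)⁻¹ * (r34 ^ 2)⁻¹ + (r12 ^ 2)⁻¹ * (r14 ^ 2)⁻¹ * (r34 ^ 2)⁻¹ + (r12 ^ 2)⁻¹ * (r13 ^ 2)⁻¹ * (r24 ^ 2)⁻¹ + (r13
            ^ 2)⁻¹ * (r14 ^ 2)⁻¹ * (r24 ^ 2)⁻¹ + (r12 ^ 2)⁻¹ * (r14 ^ 2)⁻¹ * (r23 ^ 2)⁻¹ + (r13 ^ 2)⁻¹ * (r14 ^ 2)⁻¹ * (r23 ^ 2)⁻¹) := by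
  have hM4 : 0 ≤ M₄ := le_trans (integral_nonneg fun ω => by positivity) hM41
  have hM6 : 0 ≤ M₆ := le_trans (integral_nonneg fun ω => by positivity) hM61
  have hM2 : 0 ≤ M₂ := le_trans (integral_nonneg fun ω => sq_nonneg _) hM21
  have hC : 0 ≤ (4 * K + 3 * K ^ 2 + 4 * M₄ + 4 * M₆ + 2 * M₂ * (M₂ + M₄)) := by positivity
  exact four_point_cut_tree hC (by positivity) (by positivity) (by positivity) (by positivity) (by positivity) (by positivity)
    (cut_one hP hV hfloor hc hceil hcross hVc hV0 hV2 hJ hJ0 hrow hγ0 hγ1 hD hDC h1 h2 h3 h4 hK hr12 hr13 hr14 hr23 hr24 hr34 hB12 hB13 hB14 hB23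
        hB24 hB34 hq1 hs1 hM21 hM41 hM61 hq2 hs2 hM22 hM42 hM62 hq3 hs3 hM23 hM43 hM63 hq4 hs4 hM24 hM44 hM64)
    (cut_two hP hV hfloor hc hceil hcross hVc hV0 hV2 hJ hJ0 hrow hγ0 hγ1 hD hDC h1 h2 h3 h4 hK hr12 hr13 hr14 hr23 hr24 hr34 hB12 hB13 hB14 hB23
        hB24 hB34 hq1 hs1 hM21 hM41 hM61 hq2 hs2 hM22 hM42 hM62 hq3 hs3 hM23 hM43 hM63 hq4 hs4 hM24 hM44 hM64)
    (cut_three hP hV hfloor hc hceil hcross hVc hV0 hV2 hJ hJ0 hrow hγ0 hγ1 hD hDC h1 h2 h3 h4 hK hr12 hr13 hr14 hr23 hr24 hr34 hB12 hB13 hB14 hB23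
        hB24 hB34 hq1 hs1 hM21 hM41 hM61 hq2 hs2 hM22 hM42 hM62 hq3 hs3 hM23 hM43 hM63 hq4 hs4 hM24 hM44 hM64)
    (cut_four hP hV hfloor hc hceil hcross hVc hV0 hV2 hJ hJ0 hrow hγ0 hγ1 hD hDC h1 h2 h3 h4 hK hr12 hr13 hr14 hr23 hr24 hr34 hB12 hB13 hB14 hB23
        hB24 hB34 hq1 hs1 hM21 hM41 hM61 hq2 hs2 hM22 hM42 hM62 hq3 hs3 hM23 hM43 hM63 hq4 hs4 hM24 hM44 hM64)
    (cut_one_two hP hV hfloor hc hceil hcross hVc hV0 hV2 hJ hJ0 hrow hγ0 hγ1 hD hDC h1 h2 h3 h4 hK hr13 hr14 hr23 hr24 hB13 hB14 hB23 hB24 hq1 hs1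
        hM21 hM41 hM61 hq2 hs2 hM22 hM42 hM62 hq3 hs3 hM23 hM43 hM63 hq4 hs4 hM24 hM44 hM64)
    (cut_one_three hP hV hfloor hc hceil hcross hVc hV0 hV2 hJ hJ0 hrow hγ0 hγ1 hD hDC h1 h2 h3 h4 hK hr12 hr14 hr23 hr34 hB12 hB14 hB23 hB34 hq1 hs1
        hM21 hM41 hM61 hq2 hs2 hM22 hM42 hM62 hq3 hs3 hM23 hM43 hM63 hq4 hs4 hM24 hM44 hM64)
    (cut_one_four hP hV hfloor hc hceil hcross hVc hV0 hV2 hJ hJ0 hrow hγ0 hγ1 hD hDC h1 h2 h3 h4 hK hr12 hr13 hr24 hr34 hB12 hB13 hB24 hB34 hq1 hs1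
        hM21 hM41 hM61 hq2 hs2 hM22 hM42 hM62 hq3 hs3 hM23 hM43 hM63 hq4 hs4 hM24 hM44 hM64)

end Summit.QuantumFields.BalabanUV.T4Continuum.NE7b.SupFourthCumulantTree

end
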